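import Mathlib
import HarnessLib
import Literature.ModelTheory.FiniteModelTheory.StructCkEquiv
import Summits.ValiantsHypothesis.ValiantsHypothesis.Theorems.SymmetryDialAffinePebble
import Summits.ValiantsHypothesis.ValiantsHypothesis.Theorems.SymmetryDialDisalignedCFI
import Summits.ValiantsHypothesis.ValiantsHypothesis.Theorems.SymmetryDialDisalignedCFIDisplacement
import Summits.ValiantsHypothesis.ValiantsHypothesis.Theorems.SymmetryDialDisalignedCFIShear
import Summits.ValiantsHypothesis.ValiantsHypothesis.Theorems.SymmetryDialShearStrategy

/-!
# Symmetry dial — the clean-protected-blocks invariant (NODE-g9 §B.10, lens 1, g9)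

The bookkeeping half of the affine-shear lemma (S4), on top of the strategy-introduction kernel
`SymmetryDialShearStrategy`: Duplicator's invariant is «every PROTECTED base pair of the configuration
left after removing the latest pebble has equal blocks in `cfiMat D S t` and in the retwisted
`cfiMat D S (t' + ∂(L+c))`», for an arbitrary PROTECTION SCHEME `prot` (protected ordered base pairs as
a function of the position) that contains the stars of the pinned base points.  The theorem
`affinePebbleEquiv_of_protScheme` reduces the `k`-pebble game `AffinePebbleEquiv k` on
`𝔄(cfiMat D S t)`, `𝔄(cfiMat D S t')` to ONE re-clearing statement (`hmove`): from «`prot` of the board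
minus pebble `i₀` is clean for `(L, c)`» produce `(L', c')` AGREEING with `(L, c)` on the pebbles
`j ≠ i` (the linear system `L'(p) + c' = L(p) + c` per pinned point, `Lᵀ'β = Lᵀβ` per pebbled dual:
`shearSum_agree_inl/inr`) with «`prot` of the board minus pebble `i` clean for `(L', c')`» (clean = equal blocks, spelled out inline).  That
statement is pure linear algebra over `𝔽₂` (the certificate `COND_k` of NODE-g9 §B.2 is its rank
form); no game remains.  Off-by-one made explicit: the configuration Duplicator re-clears is the board
MINUS the lifted pebble (≤ k−1 pebbles), before the new placement — the enumeration of the certifier.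
-/

set_option linter.dupNamespace false

namespace Summit.ValiantsHypothesis.ValiantsHypothesis.Theorems.SymmetryDialShearInvariant

open Literature.ModelTheory.FiniteModelTheory
open SymmetryDialAffinePebble (V pair Laff affStr AffinePebbleEquiv affinePebbleEquiv_zero)
open SymmetryDialDisalignedCFI (base fib Design cfiMat)
open SymmetryDialDisalignedCFIDisplacement (base_append fib_append cfiMat_apply)
open SymmetryDialDisalignedCFIShear (shear shearFun cobd dualShear transp append_base_fib eq_iff_base_fib)
open SymmetryDialShearStrategy (ShearParam shearSum shearSum_inl shearSum_inr affinePebbleEquiv_of_shearInvariant)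

variable {d₀ r δ : ℕ}

/-! ## §1 Blocks of the compact CFI matrix and their dependence on the twist -/

/-- Positions of the `k`-pebble game on the two-sorted universe `𝔽₂^n ⊔ 𝔽₂^n`. -/
abbrev Pos (k n : ℕ) : Type := Fin k → Option (V n ⊕ V n)

/-- The retwist of `t'` by the coboundary of the affine shear `(L, c)`. -/
def twistOf (D : Design d₀ r δ) (t' : V d₀ → V d₀ → Fin 2) (φ : ShearParam d₀ r) : V d₀ → V d₀ → Fin 2 :=
  fun v w => t' v w + cobd D (fun u => φ.1.1 u + φ.2) v w

/-- An entry of `cfiMat` depends on the twist only through its value on the base pair. -/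
theorem cfiMat_congr (D : Design d₀ r δ) (S : V d₀ → V r → Bool) (t t'' : V d₀ → V d₀ → Fin 2)
    (x y : V (d₀ + r)) (h : t (base x) (base y) = t'' (base x) (base y)) :
    cfiMat D S t (x, y) = cfiMat D S t'' (x, y) := by
  rw [Bool.eq_iff_iff, cfiMat_apply, cfiMat_apply, h]

/-- Blocks agree where the twists agree. -/
theorem blockEq_of_twist_eq (D : Design d₀ r δ) (S : V d₀ → V r → Bool) (t t'' : V d₀ → V d₀ → Fin 2)
    (v w : V d₀) (h : t v w = t'' v w) (a b : V r) :
    cfiMat D S t (Fin.append v a, Fin.append w b) = cfiMat D S t'' (Fin.append v a, Fin.append w b) := by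
  apply cfiMat_congr
  rw [base_append, base_append]; exact h

/-- Same-fibre entries do not depend on the twist (the generators are nonzero). -/
theorem cfiMat_eq_of_base_eq (D : Design d₀ r δ) (hgen : ∀ i, D.gen i ≠ 0) (S : V d₀ → V r → Bool)
    (t t'' : V d₀ → V d₀ → Fin 2) (x y : V (d₀ + r)) (h : base x = base y) :
    cfiMat D S t (x, y) = cfiMat D S t'' (x, y) := by
  have hno : ∀ i, ¬ base y = base x + D.gen i := by
    intro i hi
    apply hgen i
    rw [h] at hi
    have h2 : base y + D.gen i = base y + 0 := by rw [add_zero]; exact hi.symm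
    exact add_left_cancel h2
  rw [Bool.eq_iff_iff, cfiMat_apply, cfiMat_apply]
  simp only [hno, false_and, exists_false, or_false]

/-- Non-adjacent, distinct base pairs: the block is zero for every twist. -/
theorem cfiMat_eq_of_not_adj (D : Design d₀ r δ) (S : V d₀ → V r → Bool) (t t'' : V d₀ → V d₀ → Fin 2)
    (x y : V (d₀ + r)) (h : base x ≠ base y) (hna : ∀ i, base y ≠ base x + D.gen i) :
    cfiMat D S t (x, y) = cfiMat D S t'' (x, y) := by
  rw [Bool.eq_iff_iff, cfiMat_apply, cfiMat_apply]
  simp only [h, hna, false_and, exists_false, or_false]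

/-! ## §2 The agreement constraints are the linear system `U(R)` -/

/-- Two shears agree on a POINT `x` iff `L'(v) + c' = L(v) + c` for `v = base x`. -/
theorem shearSum_agree_inl (L L' : V d₀ → V r) (c c' : V r) (x : V (d₀ + r)) :
    shearSum L' c' (.inl x) = shearSum L c (.inl x) ↔ L' (base x) + c' = L (base x) + c := by
  rw [shearSum_inl, shearSum_inl, Sum.inl.injEq, SymmetryDialDisalignedCFIShear.shear_apply,
    SymmetryDialDisalignedCFIShear.shear_apply]
  unfold shearFun
  rw [eq_iff_base_fib, base_append, base_append, fib_append, fib_append]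
  simp only [true_and]
  rw [add_right_inj]

/-- Two shears agree on a DUAL `ξ` iff `Lᵀ' β = Lᵀ β` for `β = fib ξ`. -/
theorem shearSum_agree_inr (L L' : V d₀ → V r) (c c' : V r) (ξ : V (d₀ + r)) :
    shearSum L' c' (.inr ξ) = shearSum L c (.inr ξ) ↔ transp L' (fib ξ) = transp L (fib ξ) := by
  rw [shearSum_inr, shearSum_inr, Sum.inr.injEq]
  unfold dualShear
  rw [eq_iff_base_fib, base_append, base_append, fib_append, fib_append]
  simp only [and_true]
  rw [add_right_inj]

/-! ## §3 The invariant and the reduction of the game to re-clearing -/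

/-- **The game reduced to re-clearing a protection scheme.**  Let `prot s v w` (protected ordered base
pairs of a position) contain both orientations of every pair with a pinned end (`hstar`).  If some
shear is clean on `prot` of the empty position (`h0`), and from «`prot (s − i₀)` clean for `φ`» one can
always pass to a shear `φ'` agreeing with `φ` on the pebbles `j ≠ i` with «`prot (s − i)` clean for
`φ'`» (`hmove`; for `i = i₀` take `φ' = φ`), then `𝔄(cfiMat D S t) ≡_{C^k} 𝔄(cfiMat D S t')`.
Duplicator's invariant: `∃ i₀, prot (s − i₀)` is clean — `i₀` is the latest pebble. -/
theorem affinePebbleEquiv_of_protScheme {k : ℕ} (D : Design d₀ r δ) (hD : D.Good)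
    (S : V d₀ → V r → Bool) (t t' : V d₀ → V d₀ → Fin 2)
    (prot : Pos k (d₀ + r) → V d₀ → V d₀ → Prop)
    (hstar : ∀ (s : Pos k (d₀ + r)) (v w : V d₀), (∃ (j : Fin k) (x : V (d₀ + r)), s j = some (.inl x) ∧ base x = v) →
      prot s v w ∧ prot s w v)
    (h0 : ∃ φ : ShearParam d₀ r, (∀ v w, prot (fun _ => none) v w → ∀ a b : V r,
        cfiMat D S t (Fin.append v a, Fin.append w b) = cfiMat D S (twistOf D t' φ) (Fin.append v a, Fin.append w b)))
    (hmove : ∀ (φ : ShearParam d₀ r) (s : Pos k (d₀ + r)) (i i₀ : Fin k),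
      (∀ v w, prot (Function.update s i₀ none) v w → ∀ a b : V r,
        cfiMat D S t (Fin.append v a, Fin.append w b) = cfiMat D S (twistOf D t' φ) (Fin.append v a, Fin.append w b)) →
        ∃ φ' : ShearParam d₀ r,
          (∀ j, j ≠ i → ∀ z, s j = some z → shearSum φ'.1.1 φ'.2 z = shearSum φ.1.1 φ.2 z) ∧
            (∀ v w, prot (Function.update s i none) v w → ∀ a b : V r,
              cfiMat D S t (Fin.append v a, Fin.append w b) = cfiMat D S (twistOf D t' φ') (Fin.append v a, Fin.append w b))) :
    AffinePebbleEquiv k (d₀ + r) (cfiMat D S t) (cfiMat D S t') := by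
  rcases Nat.eq_zero_or_pos k with rfl | hk
  · exact affinePebbleEquiv_zero _ _ _
  have hinj : Function.Injective D.gen := hD.2.1
  have hgen : ∀ i, D.gen i ≠ 0 := hD.2.2.1
  refine affinePebbleEquiv_of_shearInvariant D hinj S t t'
    (fun φ s => ∃ i₀ : Fin k, (∀ v w, prot (Function.update s i₀ none) v w → ∀ a b : V r,
      cfiMat D S t (Fin.append v a, Fin.append w b) = cfiMat D S (twistOf D t' φ) (Fin.append v a, Fin.append w b))) ?_ ?_ ?_
  · -- the empty board
    obtain ⟨φ, hφ⟩ := h0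
    refine ⟨φ, ⟨0, hk⟩, ?_⟩
    have he : Function.update (fun _ : Fin k => (none : Option (V (d₀ + r) ⊕ V (d₀ + r)))) ⟨0, hk⟩ none =
        fun _ => none := by
      funext j; simp [Function.update_apply]
    rw [he]; exact hφ
  · -- pebbled points span clean blocks
    rintro φ s ⟨i₀, hc⟩ x y ⟨jx, hjx⟩ ⟨jy, hjy⟩
    show cfiMat D S t (x, y) = cfiMat D S (twistOf D t' φ) (x, y)
    by_cases hx : jx = i₀
    · by_cases hy : jy = i₀
      · -- the same pebble: `x = y`, a same-fibre entry
        subst hx; subst hy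
        rw [hjx] at hjy
        have hxy : x = y := Sum.inl_injective (Option.some_injective _ hjy)
        subst hxy
        exact cfiMat_eq_of_base_eq D hgen S t _ x x rfl
      · have hpin : ∃ (j : Fin k) (x' : V (d₀ + r)), Function.update s i₀ none j = some (.inl x') ∧ base x' = base y :=
          ⟨jy, y, by rw [Function.update_of_ne hy]; exact hjy, rfl⟩
        have hb := hc _ _ (hstar _ _ (base x) hpin).2 (fib x) (fib y)
        rwa [append_base_fib, append_base_fib] at hb
    · have hpin : ∃ (j : Fin k) (x' : V (d₀ + r)), Function.update s i₀ none j = some (.inl x') ∧ base x' = base x :=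
        ⟨jx, x, by rw [Function.update_of_ne hx]; exact hjx, rfl⟩
      have hb := hc _ _ (hstar _ _ (base y) hpin).1 (fib x) (fib y)
      rwa [append_base_fib, append_base_fib] at hb
  · -- lift-and-place: re-clear `prot (s − i)`, then `i` is the latest pebble
    rintro φ s ⟨i₀, hc⟩ i
    obtain ⟨φ', hagree, hclean⟩ := hmove φ s i i₀ hc
    refine ⟨φ', hagree, fun z => ⟨i, ?_⟩⟩
    rw [Function.update_idem]
    exact hclean

end Summit.ValiantsHypothesis.ValiantsHypothesis.Theorems.SymmetryDialShearInvariant
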